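import Summits.BirchSwinnertonDyer.Rank1Residual.X5.TwoAdicTargetsMultKatoIntSplit
import Summits.BirchSwinnertonDyer.BirchSwinnertonDyer.Theorems.ByReductionTypeAtTwoMultUpperHalfKatoIntDefs
import HarnessLib

/-!
# Route ByReductionTypeAtTwo, crux `MultUpperHalfAtTwo` (stmt-BirchSwinnertonDyer-19922) — two further CLOSED
# `Prop` leaves (Theses-free module, importable by the route file): the integral-Kato door at a SPLIT `2` for
# every curve (T-KATO2-SPMULT), and the residual OFF FIVE roads

Companion of `ByReductionTypeAtTwoMultUpperHalfDefs.lean` (p420550) and `…KatoIntDefs.lean` (p425255; leaves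
`KatoIntAtNonsplitSurjectiveTwo`, `KatoUpToOneAtNonsplitSurjectiveTwo`, `UpperHalfOffFourRoadsAtMultTwo`) for
the reduction `Theorems.multUpperHalfAtTwo_of_fiveRoads_of_eulerChar` (seat `bsd-2adic-mult` GEN 7, file
`ByReductionTypeAtTwoMultUpperHalfFiveRoads.lean`): that theorem carries two binders the earlier leaves do not
name — the SPLIT door T-KATO2-SPMULT for every curve (`hKintSp`, kernel p433154
`X5/TwoAdicTargetsMultKatoIntSplit.lean`, memo HOME/mult/PROOF-KATO2SPLIT.md @7caaefd99ad4a0cb, referee pending)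
and the SMALLER residual `hoff` (optimal curves off the `μ = 0` road, off the Prop-5.14 road, off the
non-split sharp door's locus, off the non-split parity road AND off the split door's locus «split ∧
`TwoAdicSurjective` ∧ `Δ < 0`»). Each constant below is the corresponding binder VERBATIM (`@[conjecture]`,
nothing asserted); `Iff.rfl` lemmas record that nothing was changed; this module imports no Theses file.

HONEST FRAMING (cell `bsd-2adic`): typed targets only; nothing asserted, nothing booked; BSD is not proved
by any of this. PARTITION: X5@2 mult (K4ᵐ, B1·O1; 1 976 classes; the fifth road covers the 437 split ∧
surjective ∧ `Δ < 0` classes of CENSUS-6, 436 of rank `0`) × p = 2 — types-the-object-of; closes none.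
-/

set_option autoImplicit false
set_option linter.dupNamespace false

noncomputable section

open scoped Classical MatrixGroups ModularForm

open CongruenceSubgroup WeierstrassCurve Literature.NumberTheory.EllipticCurves
  Literature.NumberTheory.EllipticCurves.ModularForms
  Literature.NumberTheory.EllipticCurves.Greenberg1999
  Literature.NumberTheory.EllipticCurves.Rank1Residual
  Literature.NumberTheory.EllipticCurves.Rank1Residual.Typed
  Summit.BirchSwinnertonDyer.Rank1Residual.X5

namespace Summit.BirchSwinnertonDyer.BirchSwinnertonDyer.Theorems.MultUpperHalvesAtTwo

/-- [crux, MEMO] **T-KATO2-SPMULT for every curve** — the binder `hKintSp` of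
`Theorems.multUpperHalfAtTwo_of_fiveRoads_of_eulerChar`: the displayed statement
`O1.KatoDivisibilityAtTwoSplitMultInt W` (kernel p433154) for every globally minimal elliptic `W/ℚ` — Kato's
divisibility `T · char_Λ X(E/ℚ_∞) ∋ T·g`, `ι(T·g) = ϖ·L`, IN `Λ = ℤ₂⟦T⟧` with the `2`-power part and the
trivial zero divided out on the analytic side, for `W` SPLIT multiplicative at `2` with
`ρ_{E,2^∞}(G_ℚ) = GL₂(ℤ₂)` and `Δ_W < 0` (vacuous off that guard). Memo-proved in the cell (HOME
mult/PROOF-KATO2SPLIT.md v1 Thm. B: the non-split transport of PROOF-KATO2MULT plus two local lemmas — the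
Δ-descent is onto by local class field theory, and Kato's Coleman sentence (proof of Lemma 17.12, p. 278) on
norm-coherent units; referee pending), NOT in print (Kato Thm. 17.4 assumes `p ∤ N`; Kobayashi 2006 Thm. 4.1
and Wuthrich 2014 Cor. 19 keep `p` odd). Nothing asserted.
[cite: Kato2004Asterisque, Lemma 17.12 proof (p. 278), Prop. 17.11, 17.13 (pp. 277–280) (shape)]
[cite: Kobayashi2006DocMath, Thm. 4.1 (odd p; shape)] [cite: Wuthrich2014, Cor. 19 (odd p; shape)] -/
@[conjecture] def KatoIntAtSplitSurjectiveTwo : Prop :=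
  ∀ (W : WeierstrassCurve ℚ) [W.IsElliptic] [W.IsGloballyMinimal], O1.KatoDivisibilityAtTwoSplitMultInt W

/-- [crux, RESIDUAL] **The upper half OFF the five roads** — the binder `hoff` of
`Theorems.multUpperHalfAtTwo_of_fiveRoads_of_eulerChar` VERBATIM: `MissingUpperBoundAt W₀ 2` for every
`X₀(N)`-optimal globally minimal non-CM `W₀` of analytic rank `0` multiplicative at `2` (lattice-optimal
parametrisation datum at level `N_{W₀}`) that is (i) off the `μ = 0` road, (ii) off the Prop-5.14 road,
(iii) off the locus of the non-split sharp door (NOT: non-split ∧ `TwoAdicSurjective` ∧ `Δ < 0`), (iv) off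
the non-split parity road (NOT: non-split ∧ `TwoAdicSurjective` ∧ `ord₂ #Ш_an` even) and (v) off the locus
of the SPLIT door T-KATO2-SPMULT (NOT: split ∧ `TwoAdicSurjective W₀` ∧ `Δ_{W₀} < 0`). Expected content on
the census of record: the 129 split surjective classes of positive discriminant (a split parity road would
remove them), the 52 irreducible classes with small `2`-adic image, and the 142 «neither» classes (unique
rational `2`-torsion point neither ramified nor odd, cf. 195A1 in Greenberg's LNM 1716 p. 124). Strictly
smaller than `UpperHalfOffFourRoadsAtMultTwo` (p425255). Nothing asserted.
[cite: GreenbergLNM1716, Prop. 5.13, Prop. 5.14 (pp. 120–122) and p. 124 (shape)] [cite: Miller2011LMS, Def. 1.1]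
[cite: SilvermanAEC2009, Thm. X.4.14 (square order of Ш; shape)] -/
@[conjecture] def UpperHalfOffFiveRoadsAtMultTwo : Prop :=
  ∀ (W₀ : WeierstrassCurve ℚ) [W₀.IsElliptic] [W₀.IsGloballyMinimal]
    [NeZero (W₀.conductorNorm ℤ)], ¬ W₀.HasCM → W₀.analyticRank = 0 → Mult W₀ 2 →
    ∀ D₀ : ModularParametrizationData W₀ (W₀.conductorNorm ℤ), Zhai2021.IsOptimalDatum W₀ D₀ →
    (¬ ∀ (κ : ZpExtension ℚ 2) (γ : Field.absoluteGaloisGroup ℚ), κ.IsCyclotomic →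
        κ.IsTopGenerator γ → IsCyclotomicVariable 2 γ → ∀ D : W₀.SelmerDualData κ γ, D.mu = 0) →
    (¬ ∃ x y : ℚ, W₀.toAffine.Equation x y ∧ 2 * y + W₀.a₁ * x + W₀.a₃ = 0 ∧
        ((TwoTorsionRamifiedAtTwo x ∧ ¬ TwoTorsionOdd W₀ x) ∨
          (TwoTorsionOdd W₀ x ∧ ¬ TwoTorsionRamifiedAtTwo x))) →
    ¬ (¬ W₀.HasSplitMultiplicativeReductionAtPrime 2 ∧ O1.TwoAdicSurjective W₀ ∧ W₀.Δ < 0) →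
    ¬ (¬ W₀.HasSplitMultiplicativeReductionAtPrime 2 ∧ O1.TwoAdicSurjective W₀ ∧
        ∃ q : ℚ, shaAn W₀ = (q : ℂ) ∧ Even (padicValRat 2 q)) →
    ¬ (W₀.HasSplitMultiplicativeReductionAtPrime 2 ∧ O1.TwoAdicSurjective W₀ ∧ W₀.Δ < 0) →
    MissingUpperBoundAt W₀ 2

/-! ## Bookkeeping: the constants unfold to the binders verbatim -/

/-- `KatoIntAtSplitSurjectiveTwo` unfolds to the binder `hKintSp`. [folklore] -/
theorem katoIntAtSplitSurjectiveTwo_iff : KatoIntAtSplitSurjectiveTwo ↔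
    ∀ (W : WeierstrassCurve ℚ) [W.IsElliptic] [W.IsGloballyMinimal],
      O1.KatoDivisibilityAtTwoSplitMultInt W :=
  Iff.rfl

/-- `UpperHalfOffFiveRoadsAtMultTwo` unfolds to the binder `hoff`. [folklore] -/
theorem upperHalfOffFiveRoadsAtMultTwo_iff : UpperHalfOffFiveRoadsAtMultTwo ↔
    ∀ (W₀ : WeierstrassCurve ℚ) [W₀.IsElliptic] [W₀.IsGloballyMinimal]
      [NeZero (W₀.conductorNorm ℤ)], ¬ W₀.HasCM → W₀.analyticRank = 0 → Mult W₀ 2 →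
      ∀ D₀ : ModularParametrizationData W₀ (W₀.conductorNorm ℤ), Zhai2021.IsOptimalDatum W₀ D₀ →
      (¬ ∀ (κ : ZpExtension ℚ 2) (γ : Field.absoluteGaloisGroup ℚ), κ.IsCyclotomic →
          κ.IsTopGenerator γ → IsCyclotomicVariable 2 γ → ∀ D : W₀.SelmerDualData κ γ, D.mu = 0) →
      (¬ ∃ x y : ℚ, W₀.toAffine.Equation x y ∧ 2 * y + W₀.a₁ * x + W₀.a₃ = 0 ∧
          ((TwoTorsionRamifiedAtTwo x ∧ ¬ TwoTorsionOdd W₀ x) ∨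
            (TwoTorsionOdd W₀ x ∧ ¬ TwoTorsionRamifiedAtTwo x))) →
      ¬ (¬ W₀.HasSplitMultiplicativeReductionAtPrime 2 ∧ O1.TwoAdicSurjective W₀ ∧ W₀.Δ < 0) →
      ¬ (¬ W₀.HasSplitMultiplicativeReductionAtPrime 2 ∧ O1.TwoAdicSurjective W₀ ∧
          ∃ q : ℚ, shaAn W₀ = (q : ℂ) ∧ Even (padicValRat 2 q)) →
      ¬ (W₀.HasSplitMultiplicativeReductionAtPrime 2 ∧ O1.TwoAdicSurjective W₀ ∧ W₀.Δ < 0) →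
      MissingUpperBoundAt W₀ 2 :=
  Iff.rfl

/-- **The five-road residual is contained in the four-road one**: `UpperHalfOffFourRoadsAtMultTwo` implies
`UpperHalfOffFiveRoadsAtMultTwo` (the split-door hypothesis is dropped). Bookkeeping for the planner:
replacing the residual leaf by the new one is a weakening of what the route still needs. [folklore] -/
theorem upperHalfOffFiveRoadsAtMultTwo_of_offFourRoads (h : UpperHalfOffFourRoadsAtMultTwo) :
    UpperHalfOffFiveRoadsAtMultTwo :=
  fun W₀ _ _ _ hcm hr hmult D₀ hopt hμ h514 hdoor hpar _ ↦ h W₀ hcm hr hmult D₀ hopt hμ h514 hdoor hpar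


/-! ## Appended (seat `bsd-2adic-mult-2` GEN 3): the split door at slack ONE and the residual off SIX roads

The reduction `Theorems.multUpperHalfAtTwo_of_sixRoads'` (file `ByReductionTypeAtTwoMultUpperHalfKatoIntSplit.lean`,
seat `bsd-2adic-mult-2` GEN 3) adds the SPLIT PARITY road (vi) to the five roads: it carries two binders the leaves
above do not name — the split door at slack ONE for every split surjective curve (`hK1sp`: `ι(T·g) = 2ϖ·L`, the
`Δ > 0` face of PROOF-KATO2SPLIT Thm. B with `c_∞ = 2`; the X5 display `O1.KatoDivisibilityAtTwoSplitMultInt` is the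
`Δ < 0` statement only, so the binder is spelled out) and the SMALLER residual off SIX roads. Census (r0, HOME
mult/step0/KATO2/census6-all.tsv): six roads 1 775 / 1 969 (the sixth removes the 129 split surjective `Δ > 0`
classes, «`ord₂ #Ш_an` even» certified on 129/129); residual 194 = 52 small `2`-adic image + 142 «neither». -/

/-- [crux, MEMO] **T-KATO2-SPMULT at slack ONE for every split surjective curve** — the binder `hK1sp` of
`Theorems.multUpperHalfAtTwo_of_sixRoads'` VERBATIM: for `W` globally minimal, multiplicative and SPLIT at `2` with
`ρ_{E,2^∞}` surjective (NO sign condition on `Δ`), every cyclotomic datum `(κ, γ)`, the newform `f` at level `N_W`,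
every `ϖ` with `ϖ·Ω_W = Ω⁺_f`, every split `2`-adic `L`-function `L` of `f` and every dual datum `D`: `X` torsion and
`ι(T·g) = 2ϖ·L` for some `g ∈ char_Λ X`. This is PROOF-KATO2SPLIT Thm. B (`L₂^{Ω⁺_E} ∈ TΛ`, `T·char X ∣ L₂^{Ω⁺_E}`)
in the tree's normalisation `L₂^{Ω⁺_E} = c_∞·ϖ·L`, `c_∞ = #π₀E(ℝ) ≤ 2` (memo Cor. D (i): «slack exactly 1 when
`Δ_E > 0`»); on `Δ < 0` it follows from `KatoIntAtSplitSurjectiveTwo` (`g ↦ 2g`). Memo-proved (referee pending), NOT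
in print. Nothing asserted. [cite: Kato2004Asterisque, Lemma 17.12 proof (p. 278) and Thm. 17.13 (pp. 279–280) (shape)]
[cite: MazurTateTeitelbaum1986Invent, §I.10 and §I.14–15 (the object; L(0) = 0 at a split prime)] -/
@[conjecture] def KatoUpToOneAtSplitSurjectiveTwo : Prop :=
  ∀ (W : WeierstrassCurve ℚ) [W.IsElliptic] [W.IsGloballyMinimal],
    Mult W 2 → W.HasSplitMultiplicativeReductionAtPrime 2 → O1.TwoAdicSurjective W →
    ∀ (κ : ZpExtension ℚ 2) (γ : Field.absoluteGaloisGroup ℚ), κ.IsCyclotomic → κ.IsTopGenerator γ →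
    IsCyclotomicVariable 2 γ →
    ∀ [NeZero (W.conductorNorm ℤ)] (f : CuspForm (Gamma0 (W.conductorNorm ℤ)) 2), IsNewformOf W f →
    ∀ ϖ : ℚ, (ϖ : ℝ) * W.realPeriodRat = plusPeriod f →
    ∀ L : PowerSeries ℚ_[2], IsSplitMultPAdicLFunctionOf f 2 L → ∀ D : W.SelmerDualData κ γ,
      D.IsTorsion ∧ ∃ g ∈ D.charIdeal,
        iwasawaToPowerSeries 2 (PowerSeries.X * g) = PowerSeries.C ((2 * ϖ : ℚ) : ℚ_[2]) * L

/-- [crux, RESIDUAL] **The upper half OFF the six roads** — the binder `hoff` of `Theorems.multUpperHalfAtTwo_of_sixRoads'`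
VERBATIM: `MissingUpperBoundAt W₀ 2` for every `X₀(N)`-optimal globally minimal non-CM `W₀` of analytic rank `0`
multiplicative at `2` (lattice-optimal parametrisation datum at level `N_{W₀}`) that is (i) off the `μ = 0` road, (ii)
off the Prop-5.14 road, (iii) off the sharp non-split door (NOT: non-split ∧ `TwoAdicSurjective` ∧ `Δ < 0`), (iv) off
the non-split parity road (NOT: non-split ∧ `TwoAdicSurjective` ∧ `ord₂ #Ш_an` even), (v) off the sharp SPLIT door
(NOT: split ∧ `TwoAdicSurjective` ∧ `Δ < 0`) and (vi) off the split parity road (NOT: split ∧ `TwoAdicSurjective` ∧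
`ord₂ #Ш_an` even). Expected content (census, r0): the 52 `E[2]`-irreducible classes with non-surjective `ρ_{E,2^∞}`
(Rubin's Hyp(ℚ_∞,T) fails — no Euler-system door) and the 142 «neither» classes (unique rational `2`-torsion point
neither ramified nor odd at the optimal curve, cf. 195A in Greenberg's LNM 1716 p. 124): there `μ(X(E₀/ℚ_∞)) = 0` is
needed and is not in print; plus, at the ∀-level, surjective curves with `ord₂ #Ш_an` odd (none expected under BSD).
Strictly smaller than `UpperHalfOffFiveRoadsAtMultTwo`. Nothing asserted.
[cite: GreenbergLNM1716, Prop. 5.13, Prop. 5.14 (pp. 120–122) and p. 124 (shape)] [cite: Miller2011LMS, Def. 1.1]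
[cite: SilvermanAEC2009, Thm. X.4.14 (square order of Ш; shape)] -/
@[conjecture] def UpperHalfOffSixRoadsAtMultTwo : Prop :=
  ∀ (W₀ : WeierstrassCurve ℚ) [W₀.IsElliptic] [W₀.IsGloballyMinimal]
    [NeZero (W₀.conductorNorm ℤ)], ¬ W₀.HasCM → W₀.analyticRank = 0 → Mult W₀ 2 →
    ∀ D₀ : ModularParametrizationData W₀ (W₀.conductorNorm ℤ), Zhai2021.IsOptimalDatum W₀ D₀ →
    (¬ ∀ (κ : ZpExtension ℚ 2) (γ : Field.absoluteGaloisGroup ℚ), κ.IsCyclotomic →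
        κ.IsTopGenerator γ → IsCyclotomicVariable 2 γ → ∀ D : W₀.SelmerDualData κ γ, D.mu = 0) →
    (¬ ∃ x y : ℚ, W₀.toAffine.Equation x y ∧ 2 * y + W₀.a₁ * x + W₀.a₃ = 0 ∧
        ((TwoTorsionRamifiedAtTwo x ∧ ¬ TwoTorsionOdd W₀ x) ∨
          (TwoTorsionOdd W₀ x ∧ ¬ TwoTorsionRamifiedAtTwo x))) →
    ¬ (¬ W₀.HasSplitMultiplicativeReductionAtPrime 2 ∧ O1.TwoAdicSurjective W₀ ∧ W₀.Δ < 0) →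
    ¬ (¬ W₀.HasSplitMultiplicativeReductionAtPrime 2 ∧ O1.TwoAdicSurjective W₀ ∧
        ∃ q : ℚ, shaAn W₀ = (q : ℂ) ∧ Even (padicValRat 2 q)) →
    ¬ (W₀.HasSplitMultiplicativeReductionAtPrime 2 ∧ O1.TwoAdicSurjective W₀ ∧ W₀.Δ < 0) →
    ¬ (W₀.HasSplitMultiplicativeReductionAtPrime 2 ∧ O1.TwoAdicSurjective W₀ ∧
        ∃ q : ℚ, shaAn W₀ = (q : ℂ) ∧ Even (padicValRat 2 q)) →
    MissingUpperBoundAt W₀ 2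

/-- `KatoUpToOneAtSplitSurjectiveTwo` unfolds to the binder `hK1sp`. [folklore] -/
theorem katoUpToOneAtSplitSurjectiveTwo_iff : KatoUpToOneAtSplitSurjectiveTwo ↔
    ∀ (W : WeierstrassCurve ℚ) [W.IsElliptic] [W.IsGloballyMinimal],
      Mult W 2 → W.HasSplitMultiplicativeReductionAtPrime 2 → O1.TwoAdicSurjective W →
      ∀ (κ : ZpExtension ℚ 2) (γ : Field.absoluteGaloisGroup ℚ), κ.IsCyclotomic → κ.IsTopGenerator γ →
      IsCyclotomicVariable 2 γ →
      ∀ [NeZero (W.conductorNorm ℤ)] (f : CuspForm (Gamma0 (W.conductorNorm ℤ)) 2), IsNewformOf W f →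
      ∀ ϖ : ℚ, (ϖ : ℝ) * W.realPeriodRat = plusPeriod f →
      ∀ L : PowerSeries ℚ_[2], IsSplitMultPAdicLFunctionOf f 2 L → ∀ D : W.SelmerDualData κ γ,
        D.IsTorsion ∧ ∃ g ∈ D.charIdeal,
          iwasawaToPowerSeries 2 (PowerSeries.X * g) = PowerSeries.C ((2 * ϖ : ℚ) : ℚ_[2]) * L :=
  Iff.rfl

/-- `UpperHalfOffSixRoadsAtMultTwo` unfolds to the binder `hoff`. [folklore] -/
theorem upperHalfOffSixRoadsAtMultTwo_iff : UpperHalfOffSixRoadsAtMultTwo ↔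
    ∀ (W₀ : WeierstrassCurve ℚ) [W₀.IsElliptic] [W₀.IsGloballyMinimal]
      [NeZero (W₀.conductorNorm ℤ)], ¬ W₀.HasCM → W₀.analyticRank = 0 → Mult W₀ 2 →
      ∀ D₀ : ModularParametrizationData W₀ (W₀.conductorNorm ℤ), Zhai2021.IsOptimalDatum W₀ D₀ →
      (¬ ∀ (κ : ZpExtension ℚ 2) (γ : Field.absoluteGaloisGroup ℚ), κ.IsCyclotomic →
          κ.IsTopGenerator γ → IsCyclotomicVariable 2 γ → ∀ D : W₀.SelmerDualData κ γ, D.mu = 0) →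
      (¬ ∃ x y : ℚ, W₀.toAffine.Equation x y ∧ 2 * y + W₀.a₁ * x + W₀.a₃ = 0 ∧
          ((TwoTorsionRamifiedAtTwo x ∧ ¬ TwoTorsionOdd W₀ x) ∨
            (TwoTorsionOdd W₀ x ∧ ¬ TwoTorsionRamifiedAtTwo x))) →
      ¬ (¬ W₀.HasSplitMultiplicativeReductionAtPrime 2 ∧ O1.TwoAdicSurjective W₀ ∧ W₀.Δ < 0) →
      ¬ (¬ W₀.HasSplitMultiplicativeReductionAtPrime 2 ∧ O1.TwoAdicSurjective W₀ ∧
          ∃ q : ℚ, shaAn W₀ = (q : ℂ) ∧ Even (padicValRat 2 q)) →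
      ¬ (W₀.HasSplitMultiplicativeReductionAtPrime 2 ∧ O1.TwoAdicSurjective W₀ ∧ W₀.Δ < 0) →
      ¬ (W₀.HasSplitMultiplicativeReductionAtPrime 2 ∧ O1.TwoAdicSurjective W₀ ∧
          ∃ q : ℚ, shaAn W₀ = (q : ℂ) ∧ Even (padicValRat 2 q)) →
      MissingUpperBoundAt W₀ 2 :=
  Iff.rfl

/-- **The six-road residual is contained in the five-road one** (the split parity hypothesis is dropped). [folklore] -/
theorem upperHalfOffSixRoadsAtMultTwo_of_offFiveRoads (h : UpperHalfOffFiveRoadsAtMultTwo) :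
    UpperHalfOffSixRoadsAtMultTwo :=
  fun W₀ _ _ _ hcm hr hmult D₀ hopt hμ h514 hdoor hpar hdoorSp _ ↦
    h W₀ hcm hr hmult D₀ hopt hμ h514 hdoor hpar hdoorSp

/-- **… and in the four-road one** (p428463's WALL of the line `four_roads`): both split hypotheses dropped. [folklore] -/
theorem upperHalfOffSixRoadsAtMultTwo_of_offFourRoads (h : UpperHalfOffFourRoadsAtMultTwo) :
    UpperHalfOffSixRoadsAtMultTwo :=
  upperHalfOffSixRoadsAtMultTwo_of_offFiveRoads (upperHalfOffFiveRoadsAtMultTwo_of_offFourRoads h)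

end Summit.BirchSwinnertonDyer.BirchSwinnertonDyer.Theorems.MultUpperHalvesAtTwo

end
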